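import Summits.BirchSwinnertonDyer.BirchSwinnertonDyer.Theorems.CyclotomicUntwistCompanionShapeLaw
import HarnessLib

/-!
# The V10 shape of `W[3]|G_{ℚ₃}` is an invariant of the `G_{ℚ₃}`-MODULE `W[3]`
# (route `CyclotomicUntwist`, K1 supply — O6 lane V10; cell `bsd-wall`, seat `bsd-line-cycu-p2` g5;
# THEOREMS ONLY)

`Additive/WildThreeResidualShape.lean` types the six shapes IRR / SPLIT / ET1 / ETM / ORD1 / ORDM of
`W[3]|G_{ℚ₃}` as POLYNOMIAL SHADOWS (roots of `Ψ₃` in `ℚ₃`, square class of `F(x₀) = Ψ₂²(x₀)`), with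
the docstring gloss "a shape is an invariant of `ρ̄|G_{ℚ₃}`". This file makes the gloss a theorem:
for elliptic `W, X / ℚ` with `(W⁄ℚ₃)[3] ≅ (X⁄ℚ₃)[3]` as `Gal(ℚ̄₃/ℚ₃)`-modules
(`O5.IsLocallyCongruentModThreeAt3 W X`) every one of the six shapes of `W` is equivalent to the same
shape of `X` (`shapes_iff_of_isLocallyCongruentModThreeAt3`), via the transport of roots, of their
uniqueness and of the sign square class (`…CompanionShapeTransport.lean`, M1) and the square-class
invariance of `(parity of v₃, unit part mod 3)` (`sq_mul_shape_invariant`, M2). In particular the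
shape is constant along any global mod-`3` congruence `W[3] ≅ X[3]` (`shapes_iff_of_equivariant`).

HONEST FRAMING: helper theorems; nothing about any particular curve is asserted; K1/K2 are neither
proved nor reduced; BSD is not proved for any curve. References: [Serre1972] §1.11; [Cremona1997] §3.8.
-/

set_option linter.dupNamespace false

noncomputable section

open scoped Classical

namespace Summit.BirchSwinnertonDyer.BirchSwinnertonDyer.Theorems.CompanionShape

open Polynomial WeierstrassCurve Literature.NumberTheory.EllipticCurves
  Summit.BirchSwinnertonDyer.Rank1Residual.Additive Summit.BirchSwinnertonDyer.Rank1Residual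

section OneDirection

variable (W X : WeierstrassCurve ℚ) [W.IsElliptic] [X.IsElliptic]
  (f : geomTorsion (W.baseChange ℚ_[3]) (3 : ℤ) ≃+ geomTorsion (X.baseChange ℚ_[3]) (3 : ℤ))
  (hf : ∀ (σ : Field.absoluteGaloisGroup ℚ_[3]) (P : geomTorsion (W.baseChange ℚ_[3]) (3 : ℤ)),
    f (σ • P) = σ • f P)

include hf in
/-- IRR transports: no `ℚ₃`-root of `Ψ₃(W)` ⟹ none of `Ψ₃(X)` (a root of `X` would come back along
`f⁻¹`). [cite: Cremona1997, §3.8 (l = 3)] -/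
theorem shapeIrrThree_of_equivariant (h : ShapeIrrThree W) : ShapeIrrThree X := by
  intro r hr
  obtain ⟨x₀, hx₀, -⟩ := exists_isRoot_Ψ₃_sq_mul_of_equivariant (X.baseChange ℚ_[3])
    (W.baseChange ℚ_[3]) f.symm (equivariant_symm _ _ f hf) hr
  exact h x₀ hx₀

include hf in
/-- SPLIT transports: two `ℚ₃`-roots of `Ψ₃(W)` ⟹ two of `Ψ₃(X)` (else `Ψ₃(X)` has at most one root
and uniqueness would come back along `f`). [cite: Cremona1997, §3.8 (l = 3)] -/
theorem shapeSplitThree_of_equivariant (h : ShapeSplitThree W) : ShapeSplitThree X := by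
  obtain ⟨r, r', hne, hr, hr'⟩ := h
  obtain ⟨x', hx', -⟩ := exists_isRoot_Ψ₃_sq_mul_of_equivariant (W.baseChange ℚ_[3])
    (X.baseChange ℚ_[3]) f hf hr
  by_contra hns
  have huniq : ∀ s : ℚ_[3], ((X.baseChange ℚ_[3]).Ψ₃).IsRoot s → s = x' := by
    intro s hs
    by_contra hsx
    exact hns ⟨s, x', hsx, hs, hx'⟩
  exact hne (isRoot_Ψ₃_unique_of_equivariant (W.baseChange ℚ_[3]) (X.baseChange ℚ_[3]) f hf
    huniq hr hr')

include hf in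
/-- **The unique stable line and its sign class transport**: `x₀ ↦ x₀'` with
`F_X(x₀') = c²·F_W(x₀)`, `c ∈ ℚ₃ˣ`. [cite: Serre1972, §1.11] -/
theorem exists_isUniqueStableLineThree_of_equivariant {x₀ : ℚ_[3]}
    (hx : IsUniqueStableLineThree W x₀) :
    ∃ x₀' : ℚ_[3], IsUniqueStableLineThree X x₀' ∧ ∃ c : ℚ_[3], c ≠ 0 ∧
      stableLineSignThree X x₀' = c ^ 2 * stableLineSignThree W x₀ := by
  obtain ⟨x₀', hx₀', c, hc0, hc⟩ := exists_isRoot_Ψ₃_sq_mul_of_equivariant (W.baseChange ℚ_[3])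
    (X.baseChange ℚ_[3]) f hf hx.1
  refine ⟨x₀', ⟨hx₀', fun r hr ↦ ?_⟩, c, hc0, hc⟩
  exact isRoot_Ψ₃_unique_of_equivariant (X.baseChange ℚ_[3]) (W.baseChange ℚ_[3]) f.symm
    (equivariant_symm _ _ f hf) hx.2 hr hx₀'

include hf in
/-- The four one-line shapes transport (parity of `v₃F` and the unit part class are square-class
invariants). [cite: Serre1972, §1.11] -/
theorem oneLineShapes_of_equivariant :
    (ShapeET1Three W → ShapeET1Three X) ∧ (ShapeETMThree W → ShapeETMThree X) ∧
      (ShapeORD1Three W → ShapeORD1Three X) ∧ (ShapeORDMThree W → ShapeORDMThree X) := by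
  have key : ∀ {x₀ : ℚ_[3]}, IsUniqueStableLineThree W x₀ → stableLineSignThree W x₀ ≠ 0 →
      ∀ ε : ℚ_[3], ∃ x₀' : ℚ_[3], IsUniqueStableLineThree X x₀' ∧ stableLineSignThree X x₀' ≠ 0 ∧
        (Even (stableLineSignThree X x₀').valuation ↔ Even (stableLineSignThree W x₀).valuation) ∧
        (UnitPartCongThree (stableLineSignThree X x₀') ε ↔
          UnitPartCongThree (stableLineSignThree W x₀) ε) := by
    intro x₀ hx hs ε
    obtain ⟨x₀', hx', c, hc0, hc⟩ := exists_isUniqueStableLineThree_of_equivariant W X f hf hx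
    obtain ⟨hval, hunit⟩ := sq_mul_shape_invariant hc0 hs
    refine ⟨x₀', hx', by rw [hc]; exact mul_ne_zero (pow_ne_zero 2 hc0) hs, ?_, by rw [hc, hunit ε]⟩
    rw [hc, hval]
    exact ⟨fun ⟨k, hk⟩ ↦ ⟨k - c.valuation, by omega⟩, fun ⟨k, hk⟩ ↦ ⟨k + c.valuation, by omega⟩⟩
  refine ⟨?_, ?_, ?_, ?_⟩
  · rintro ⟨x₀, hx, hs, hev, hu⟩
    obtain ⟨x₀', hx', hs', hev', hu'⟩ := key hx hs 1
    exact ⟨x₀', hx', hs', hev'.mpr hev, hu'.mpr hu⟩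
  · rintro ⟨x₀, hx, hs, hev, hu⟩
    obtain ⟨x₀', hx', hs', hev', hu'⟩ := key hx hs (-1)
    exact ⟨x₀', hx', hs', hev'.mpr hev, hu'.mpr hu⟩
  · rintro ⟨x₀, hx, hs, hodd, hu⟩
    obtain ⟨x₀', hx', hs', hev', hu'⟩ := key hx hs (-1)
    refine ⟨x₀', hx', hs', ?_, hu'.mpr hu⟩
    rw [← Int.not_even_iff_odd] at hodd ⊢
    exact fun h ↦ hodd (hev'.mp h)
  · rintro ⟨x₀, hx, hs, hodd, hu⟩
    obtain ⟨x₀', hx', hs', hev', hu'⟩ := key hx hs 1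
    refine ⟨x₀', hx', hs', ?_, hu'.mpr hu⟩
    rw [← Int.not_even_iff_odd] at hodd ⊢
    exact fun h ↦ hodd (hev'.mp h)

end OneDirection

/-- **The six V10 shapes are invariants of the `G_{ℚ₃}`-module `W[3]`.** For elliptic `W, X / ℚ`
with `(W⁄ℚ₃)[3] ≅ (X⁄ℚ₃)[3]` `Gal(ℚ̄₃/ℚ₃)`-equivariantly (`O5.IsLocallyCongruentModThreeAt3 W X`):
each of IRR, SPLIT, ET1, ETM, ORD1, ORDM holds for `W` iff it holds for `X`.
[cite: Serre1972, §1.11] [cite: Cremona1997, §3.8 (l = 3)] -/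
theorem shapes_iff_of_isLocallyCongruentModThreeAt3 (W X : WeierstrassCurve ℚ) [W.IsElliptic]
    [X.IsElliptic] (h : O5.IsLocallyCongruentModThreeAt3 W X) :
    (ShapeIrrThree W ↔ ShapeIrrThree X) ∧ (ShapeSplitThree W ↔ ShapeSplitThree X) ∧
      (ShapeET1Three W ↔ ShapeET1Three X) ∧ (ShapeETMThree W ↔ ShapeETMThree X) ∧
      (ShapeORD1Three W ↔ ShapeORD1Three X) ∧ (ShapeORDMThree W ↔ ShapeORDMThree X) := by
  obtain ⟨f, hf⟩ := h
  have hf' := equivariant_symm _ _ f hf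
  obtain ⟨h1, h2, h3, h4⟩ := oneLineShapes_of_equivariant W X f hf
  obtain ⟨h1', h2', h3', h4'⟩ := oneLineShapes_of_equivariant X W f.symm hf'
  exact ⟨⟨shapeIrrThree_of_equivariant W X f hf, shapeIrrThree_of_equivariant X W f.symm hf'⟩,
    ⟨shapeSplitThree_of_equivariant W X f hf, shapeSplitThree_of_equivariant X W f.symm hf'⟩,
    ⟨h1, h1'⟩, ⟨h2, h2'⟩, ⟨h3, h3'⟩, ⟨h4, h4'⟩⟩

/-- **… in particular along a GLOBAL mod-`3` congruence** `W[3] ≅ X[3]` (`Gal(ℚ̄/ℚ)`-equivariant;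
restriction to the decomposition group at `3`, `O5.isLocallyCongruentModThreeAt3_of_equivariant`).
[cite: Serre1972, §1.11] -/
theorem shapes_iff_of_equivariant (W X : WeierstrassCurve ℚ) [W.IsElliptic] [X.IsElliptic]
    (e : geomTorsion W (3 : ℤ) ≃+ geomTorsion X (3 : ℤ))
    (he : ∀ (σ : Field.absoluteGaloisGroup ℚ) (P : geomTorsion W (3 : ℤ)), e (σ • P) = σ • e P) :
    (ShapeIrrThree W ↔ ShapeIrrThree X) ∧ (ShapeSplitThree W ↔ ShapeSplitThree X) ∧
      (ShapeET1Three W ↔ ShapeET1Three X) ∧ (ShapeETMThree W ↔ ShapeETMThree X) ∧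
      (ShapeORD1Three W ↔ ShapeORD1Three X) ∧ (ShapeORDMThree W ↔ ShapeORDMThree X) :=
  shapes_iff_of_isLocallyCongruentModThreeAt3 W X (O5.isLocallyCongruentModThreeAt3_of_equivariant W X e he)

/-- The ET-side / ORD-side dichotomy is a `G_{ℚ₃}`-module invariant. [cite: Serre1972, §1.11] -/
theorem sides_iff_of_isLocallyCongruentModThreeAt3 (W X : WeierstrassCurve ℚ) [W.IsElliptic]
    [X.IsElliptic] (h : O5.IsLocallyCongruentModThreeAt3 W X) :
    (ShapeEtSideThree W ↔ ShapeEtSideThree X) ∧ (ShapeOrdSideThree W ↔ ShapeOrdSideThree X) := by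
  obtain ⟨-, -, h1, h2, h3, h4⟩ := shapes_iff_of_isLocallyCongruentModThreeAt3 W X h
  exact ⟨or_congr h1 h2, or_congr h3 h4⟩

end Summit.BirchSwinnertonDyer.BirchSwinnertonDyer.Theorems.CompanionShape

end
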